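import Mathlib
import Literature.NumberTheory.Transcendental.LandauDefectLatticeTate

/-!
# Crux `InverseLandauRationalCurves`, line `Sketch` — stub F: residual vanishing

Item stmt-KontsevichZagierPeriods-13872, stub `stub_residualVanishing`.

Let `T = P/Q` be a Tate family over `k`, `K ⊇ k(ϖ)` a field in which the image
`Q_K ∈ K[z]` of `Q` splits, and `c` a place of `K/k` lying over `ϖ = 0` (`val_c ϖ < 1`).
For coefficients `a_p ∈ K` integral at `c`, every coefficient of the loop numerator
`Σ_p a_p · Q_K /ₘ (z - p)` (sum over the distinct roots `p` of `Q_K`) has valuation `< 1`: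

* every root `r` of `Q_K` has `1 < val_c r` (the poles run to infinity as `ϖ → 0`:
  `0 = Q(r; ϖ) = ϖ · (Q div ϖ)(r; ϖ) + c₀` with `val_c c₀ = 1`);
* the coefficients of `∏_{r ∈ R} (z - r)` have valuation `≤ ∏_{r ∈ R} val_c r` when all
  `val_c r ≥ 1` (ultrametric inequality);
* `Q_K /ₘ (z - p) = lc · ∏_{roots ∖ p} (z - r)` and `val_c (lc · ∏_{roots} r) = val_c Q(0; ϖ) = 1`
  (`Q(0; ϖ) ∈ k[ϖ]` has constant term `c₀ ≠ 0`), so each summand has coefficients of valuation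
  `≤ 1 / val_c p < 1`.
-/

noncomputable section

open Polynomial
open scoped WithZero
open Literature.NumberTheory.Transcendental.AyoubRel

namespace Summit.KontsevichZagierPeriods.InverseLandau.RationalCurves

section ResidualVanishingAux

variable {k : Type*} [Field k] {K : Type*} [Field K] [Algebra k K] [Algebra (RatFunc k) K]
  [IsScalarTower k (RatFunc k) K]

/-- **Roots of `Q_K` run to infinity.** At a place `c` over `ϖ = 0`, every root `r ∈ K` of the
image of `Q` has `1 < val_c r`: otherwise `0 = Q(r; ϖ) = ϖ · (Q div ϖ)(r; ϖ) + c₀` would force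
`val_c c₀ < 1`, while `c₀ ∈ kˣ` has valuation `1`. -/
theorem residual_one_lt_val_of_aeval_eq_zero (T : TateFamily₁ k) (c : Landau.Place k K)
    (hϖ : c.val (algebraMap (RatFunc k) K RatFunc.X) < 1) {r : K}
    (hr : aeval r (TateFamily₁.toParamPoly T.Q) = 0) : 1 < c.val r := by
  haveI := c.isTrivialOn
  by_contra hle
  rw [not_lt] at hle
  have h0 : TateFamily₁.evalAt r (algebraMap (RatFunc k) K RatFunc.X) T.Q = 0 := by
    rw [← TateFamily₁.aeval_toParamPoly]; exact hr
  rw [← Polynomial.X_mul_divX_add T.Q, map_add, map_mul, TateFamily₁.evalAt_X,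
    TateFamily₁.evalAt_C, T.coeff_Q_zero, Polynomial.aeval_C] at h0
  have hc₀ : c.val (algebraMap k K T.c₀) = 1 := Valuation.IsTrivialOn.eq_one _ T.c₀_ne_zero
  have key : c.val (algebraMap k K T.c₀) < 1 := by
    rw [eq_neg_of_add_eq_zero_right h0, Valuation.map_neg, map_mul]
    calc c.val (algebraMap (RatFunc k) K RatFunc.X) *
          c.val (TateFamily₁.evalAt r (algebraMap (RatFunc k) K RatFunc.X) T.Q.divX)
        ≤ c.val (algebraMap (RatFunc k) K RatFunc.X) :=
          mul_le_of_le_one_right' (TateFamily₁.val_evalAt_le_one c hle hϖ.le _)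
      _ < 1 := hϖ
  rw [hc₀] at key
  exact lt_irrefl _ key

omit [Algebra (RatFunc k) K] [IsScalarTower k (RatFunc k) K] in
/-- **Coefficient bound for products of linear factors.** If every `r ∈ R` has `1 ≤ val_c r`,
then every coefficient of `∏_{r ∈ R} (X - r)` has valuation `≤ ∏_{r ∈ R} val_c r`
(ultrametric inequality and the recursion `coeff_j ((X - r) f) = coeff_{j-1} f - r · coeff_j f`). -/
theorem residual_val_coeff_prod_X_sub_C_le (c : Landau.Place k K) (R : Multiset K)
    (hR : ∀ r ∈ R, 1 ≤ c.val r) (j : ℕ) :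
    c.val (((R.map (fun r => X - C r)).prod).coeff j) ≤ (R.map c.val).prod := by
  induction R using Multiset.induction_on generalizing j with
  | empty =>
    simp only [Multiset.map_zero, Multiset.prod_zero, coeff_one]
    split_ifs <;> simp
  | cons r R ih =>
    have hr : 1 ≤ c.val r := hR r (Multiset.mem_cons_self r R)
    have hR' : ∀ x ∈ R, 1 ≤ c.val x := fun x hx => hR x (Multiset.mem_cons_of_mem hx)
    rw [Multiset.map_cons, Multiset.prod_cons, Multiset.map_cons, Multiset.prod_cons]
    have hcoeff : ((X - C r) * (R.map (fun r => X - C r)).prod).coeff j =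
        (if j = 0 then 0 else ((R.map (fun r => X - C r)).prod).coeff (j - 1)) -
          r * ((R.map (fun r => X - C r)).prod).coeff j := by
      rw [sub_mul, coeff_sub, coeff_C_mul]
      rcases j with _ | j
      · rw [coeff_X_mul_zero, if_pos rfl]
      · rw [coeff_X_mul, if_neg (Nat.succ_ne_zero j), Nat.succ_sub_one]
    rw [hcoeff]
    refine le_trans (Valuation.map_sub _ _ _) (max_le ?_ ?_)
    · split_ifs
      · simp
      · calc c.val (((R.map (fun r => X - C r)).prod).coeff (j - 1))
            ≤ (R.map c.val).prod := ih hR' _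
          _ ≤ c.val r * (R.map c.val).prod := le_mul_of_one_le_left' hr
    · rw [map_mul]
      exact mul_le_mul_right (ih hR' j) _

/-- A polynomial in `ϖ` over `k` is integral at every place of `K/k` at which `ϖ` is. -/
theorem residual_val_algebraMap_polynomial_le_one (c : Landau.Place k K)
    (hϖ : c.val (algebraMap (RatFunc k) K RatFunc.X) ≤ 1) (p : Polynomial k) :
    c.val (algebraMap (RatFunc k) K (algebraMap (Polynomial k) (RatFunc k) p)) ≤ 1 := by
  haveI := c.isTrivialOn
  have e : algebraMap (RatFunc k) K (algebraMap (Polynomial k) (RatFunc k) p) =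
      p.eval₂ (algebraMap k K) (algebraMap (RatFunc k) K RatFunc.X) := by
    conv_lhs => rw [← Polynomial.aeval_X_left_apply (R := k) p, ← Polynomial.aeval_algebraMap_apply,
      RatFunc.algebraMap_X, ← Polynomial.aeval_algebraMap_apply]
    rw [Polynomial.aeval_def, IsScalarTower.algebraMap_eq k (RatFunc k) K]
  rw [e]
  exact c.map_eval₂_le_one _ (fun a => Valuation.IsTrivialOn.valuation_algebraMap_le_one _ a) hϖ p

/-- A polynomial in `ϖ` over `k` with non-zero constant term is a unit at every place over
`ϖ = 0`. -/
theorem residual_val_algebraMap_polynomial_eq_one (c : Landau.Place k K)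
    (hϖ : c.val (algebraMap (RatFunc k) K RatFunc.X) < 1) {p : Polynomial k} (hp : p.coeff 0 ≠ 0) :
    c.val (algebraMap (RatFunc k) K (algebraMap (Polynomial k) (RatFunc k) p)) = 1 := by
  haveI := c.isTrivialOn
  have hsplit : p = X * p.divX + C (p.coeff 0) := (X_mul_divX_add p).symm
  have hC : c.val (algebraMap (RatFunc k) K (algebraMap (Polynomial k) (RatFunc k) (C (p.coeff 0))))
      = 1 := by
    rw [Polynomial.C_eq_algebraMap, ← IsScalarTower.algebraMap_apply k (Polynomial k) (RatFunc k),
      ← IsScalarTower.algebraMap_apply k (RatFunc k) K]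
    exact Valuation.IsTrivialOn.eq_one _ hp
  have hX : c.val (algebraMap (RatFunc k) K (algebraMap (Polynomial k) (RatFunc k) (X * p.divX)))
      < 1 := by
    rw [map_mul, map_mul, RatFunc.algebraMap_X, Valuation.map_mul]
    calc c.val (algebraMap (RatFunc k) K RatFunc.X) *
          c.val (algebraMap (RatFunc k) K (algebraMap (Polynomial k) (RatFunc k) p.divX))
        ≤ c.val (algebraMap (RatFunc k) K RatFunc.X) * 1 := by
          gcongr
          exact residual_val_algebraMap_polynomial_le_one c hϖ.le _
      _ < 1 := by rw [mul_one]; exact hϖ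
  conv_lhs => rw [hsplit]
  rw [map_add, map_add, Valuation.map_add_eq_of_lt_right]
  · exact hC
  · rw [hC]; exact hX

omit [Algebra k K] [Algebra (RatFunc k) K] [IsScalarTower k (RatFunc k) K] in
/-- The constant coefficient (in `z`) of the image of `R ∈ k[z][ϖ]` in `k(ϖ)[z]` is the image of
`R(0, ϖ) ∈ k[ϖ]`. -/
theorem residual_toParamPoly_coeff_zero (R : Polynomial (Polynomial k)) :
    (TateFamily₁.toParamPoly R).coeff 0 =
      algebraMap (Polynomial k) (RatFunc k) (R.map (evalRingHom 0)) := by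
  rw [Polynomial.coeff_zero_eq_eval_zero]
  have key : ((evalRingHom (0 : RatFunc k)).comp
      (TateFamily₁.toParamPoly (k := k))) =
      (algebraMap (Polynomial k) (RatFunc k)).comp (mapRingHom (evalRingHom (0 : k))) := by
    refine Polynomial.ringHom_ext (fun q => ?_) ?_
    · simp only [RingHom.coe_comp, Function.comp_apply, coe_evalRingHom, coe_mapRingHom,
        map_C, TateFamily₁.toParamPoly, coe_eval₂RingHom, eval₂_C]
      rw [Polynomial.eval_map, Polynomial.eval₂_at_zero, Polynomial.coeff_zero_eq_eval_zero,
        IsScalarTower.algebraMap_apply k (Polynomial k) (RatFunc k), Polynomial.algebraMap_eq]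
    · simp only [RingHom.coe_comp, Function.comp_apply, coe_evalRingHom, coe_mapRingHom,
        map_X, TateFamily₁.toParamPoly, coe_eval₂RingHom, eval₂_X, eval_C]
      rfl
  exact congr_fun (congr_arg DFunLike.coe key) R

/-- **Normalisation.** At a place over `ϖ = 0`, the image `Q_K` of the denominator of a Tate
family satisfies `val_c (Q_K(0)) = 1`: `Q_K(0)` is the image of `Q(0, ϖ) ∈ k[ϖ]`, whose constant
term is `c₀ ≠ 0`. -/
theorem residual_val_eval_zero_eq_one (T : TateFamily₁ k) (c : Landau.Place k K)
    (hϖ : c.val (algebraMap (RatFunc k) K RatFunc.X) < 1) :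
    c.val (((TateFamily₁.toParamPoly T.Q).map (algebraMap (RatFunc k) K)).eval 0) = 1 := by
  rw [Polynomial.eval_map, Polynomial.eval₂_at_zero, residual_toParamPoly_coeff_zero]
  refine residual_val_algebraMap_polynomial_eq_one c hϖ ?_
  rw [Polynomial.coeff_map, T.coeff_Q_zero, Polynomial.coe_evalRingHom, Polynomial.eval_C]
  exact T.c₀_ne_zero

end ResidualVanishingAux

/-- **Residual vanishing.** Let `c` be a place of `K ⊇ k(ϖ)` over `ϖ = 0` and suppose the image
`Q_K` of `Q` splits in `K`. For coefficients `a_p` integral at `c`, every coefficient of the loop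
numerator `Σ_p a_p · Q_K/(X - p)` (sum over the distinct roots `p` of `Q_K`) has valuation `< 1`:
each root has `val > 1` (poles run to infinity), the coefficients of `Q_K/(X - p)` are
`lc · e_j(roots ∖ p)`, and `val(lc · ∏ roots) = val Q(0, ϖ) = 1`. -/
theorem stub_residualVanishing
    {k : Type*} [Field k] (T : TateFamily₁ k) {K : Type*} [Field K] [DecidableEq K] [Algebra k K]
    [Algebra (RatFunc k) K] [IsScalarTower k (RatFunc k) K]
    (c : Landau.Place k K) (hϖ : c.val (algebraMap (RatFunc k) K RatFunc.X) < 1)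
    (hsplit : ((TateFamily₁.toParamPoly T.Q).map (algebraMap (RatFunc k) K)).Splits)
    (a : K → K) (ha : ∀ x, c.val (a x) ≤ 1) (i : ℕ) :
    c.val ((∑ p ∈ ((TateFamily₁.toParamPoly T.Q).map (algebraMap (RatFunc k) K)).roots.toFinset,
      a p • (((TateFamily₁.toParamPoly T.Q).map (algebraMap (RatFunc k) K)) /ₘ (X - C p))).coeff
        i) < 1 := by
  -- normalisation: `val (lc) * ∏_{roots} val r = val (Q_K(0)) = 1`
  have hnorm : c.val ((TateFamily₁.toParamPoly T.Q).map (algebraMap (RatFunc k) K)).leadingCoeff *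
      ((((TateFamily₁.toParamPoly T.Q).map (algebraMap (RatFunc k) K)).roots).map c.val).prod
        = 1 := by
    rw [← residual_val_eval_zero_eq_one T c hϖ, hsplit.eval_eq_prod_roots, map_mul,
      map_multiset_prod, Multiset.map_map]
    congr 2
    refine Multiset.map_congr rfl fun r _ => ?_
    rw [Function.comp_apply, zero_sub, Valuation.map_neg]
  set QK := (TateFamily₁.toParamPoly T.Q).map (algebraMap (RatFunc k) K) with hQK
  -- every root runs to infinity
  have hroot : ∀ r ∈ QK.roots, 1 < c.val r := fun r hr =>
    residual_one_lt_val_of_aeval_eq_zero T c hϖ (by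
      rw [Polynomial.aeval_def, ← Polynomial.eval_map, ← hQK]
      exact (mem_roots'.1 hr).2)
  rw [finsetSum_coeff]
  refine Valuation.map_sum_lt _ one_ne_zero fun p hp => ?_
  rw [Multiset.mem_toFinset] at hp
  have hp1 : 1 < c.val p := hroot p hp
  -- `Q_K /ₘ (X - p) = lc · ∏_{roots ∖ p} (X - r)`
  have hE : QK /ₘ (X - C p) =
      C QK.leadingCoeff * ((QK.roots.erase p).map (fun r => X - C r)).prod := by
    have h1 : QK =
        (X - C p) * (C QK.leadingCoeff * ((QK.roots.erase p).map (fun r => X - C r)).prod) := by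
      conv_lhs => rw [hsplit.eq_prod_roots, ← Multiset.cons_erase hp, Multiset.map_cons,
        Multiset.prod_cons]
      ring
    conv_lhs => rw [h1]
    exact mul_divByMonic_cancel_left _ (monic_X_sub_C p)
  -- `∏_{roots} val r = val p * ∏_{roots ∖ p} val r`
  have hprod : (QK.roots.map c.val).prod = c.val p * ((QK.roots.erase p).map c.val).prod := by
    conv_lhs => rw [← Multiset.cons_erase hp, Multiset.map_cons, Multiset.prod_cons]
  rw [hprod, mul_left_comm] at hnorm
  have hB : c.val QK.leadingCoeff * ((QK.roots.erase p).map c.val).prod < 1 := by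
    by_contra h
    rw [not_lt] at h
    have h2 : c.val p * 1 ≤
        c.val p * (c.val QK.leadingCoeff * ((QK.roots.erase p).map c.val).prod) :=
      mul_le_mul_right h _
    rw [mul_one, hnorm] at h2
    exact not_lt.2 h2 hp1
  have hR : ∀ r ∈ QK.roots.erase p, 1 ≤ c.val r := fun r hr =>
    (hroot r (Multiset.mem_of_mem_erase hr)).le
  rw [coeff_smul, hE, coeff_C_mul, smul_eq_mul, map_mul, map_mul]
  calc c.val (a p) * (c.val QK.leadingCoeff *
        c.val ((((QK.roots.erase p).map (fun r => X - C r)).prod).coeff i))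
      ≤ 1 * (c.val QK.leadingCoeff * ((QK.roots.erase p).map c.val).prod) :=
        mul_le_mul' (ha p) (mul_le_mul_right (residual_val_coeff_prod_X_sub_C_le c _ hR i) _)
    _ < 1 := by rw [one_mul]; exact hB

end Summit.KontsevichZagierPeriods.InverseLandau.RationalCurves

end
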